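import Summits.QuantumFields.YangMills.Theorems.BalabanUVNodesN12TowerForest
import HarnessLib

/-!
# BalabanUVNodes ∕ N12 — THE SLAB LEMMA of the tower forest: inside one `(n+1)`-block, a site one lattice step from a site of an `n`-sub-block whose `ν`-neighbour block lies OUTSIDE the
# `(n+1)`-block, and one unit farther from the block's centre, lies in an `n`-sub-block with the same property (its `ν`-neighbour is in the same outside `(n+1)`-block) — the label
# arithmetic behind «parents of non-face-layer sites are non-face-layer» in `…N12TowerForestRootsBj` (dag-n12-w6's Q2-DESIGN §8 face layer of a boundary block)

Cell `pub-ymgap` (HUMAN RULINGS D-0062 ∕ D-0149), WIDTH SEAT `pub-ymgap-dag-n12-w3` g3 (node N12 = [B15]; key K1⁹ `stmt-QuantumFields-27364` (KEY MAP v2), `--kind proof --supports … --as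
helper`; count-neutral).  THEOREMS ONLY (0 `def`, 0 `instance`, 0 `sorry`); consumed BY NAME: this seat's `N12TowerForest.min_val_sub_eq_of_le` (p626341), `B5Eq118OneStroke.val_iterBlockOf`,
`Prop7TentInterpolation.val_embIter`, `Prop7FlatHolonomy.sitesPerDir_zero_eq_mul_pow`, `BIJ85ScalarPropagatorSupDecayDeriv.two_mul_pow_le_sitesPerDir`, `Site.tdist` ∕ `shift` ∕ `unshift`,
`T4Continuum.walkEnd`.

CONTENTS.  `blockOf_update_congr`, `tdist_eq_add_sum_erase`, ★★ `faceLayer_of_step` (THE SLAB LEMMA: `walkEnd z′ [l] = z`, `B^{n+1} z′ = B^{n+1} z`, `tdist z′ c + 1 = tdist z c` for the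
centre `c` of that block, `y₀` a `ν`-neighbour of `B^n z′` with `blockOf y₀ ≠ B^{n+1} z` ⟹ `∃ y₁`, a `ν`-neighbour of `B^n z` on the same side, with `blockOf y₁ = blockOf y₀`; labels:
`y′ := B^n z′` lies in an extreme `ν`-slab of the block, a step off `ν` keeps the `ν`-index, a step along `ν` away from the centre keeps the slab, a step along `ν` toward the centre
contradicts the distance hypothesis — `L ≥ 3` odd, period `2L^{m+K}`).

HONEST FRAMING.  Label arithmetic; no analysis; nothing of Bałaban's asserted; N12 NOT discharged; K1⁹ NOT closed; counts unmoved (typed 28∕28 · discharged 5∕27); one finite 𝕋⁴ programme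
at fixed ε — R4 closes the conditional rung `BalabanLadder.UV` only; the Yang–Mills mass gap (Clay) is NOT proved by any of this; nothing continuum ∕ ℝ⁴ ∕ OS.
-/

noncomputable section

namespace Summit.QuantumFields.YangMills.BalabanUVNodes.N12TowerForestSlab

open scoped BigOperators
open Literature.MathematicalPhysics.QuantumFieldTheory.Balaban1983to89
open T4Continuum
open B15DeterminingSets
open B5Eq118OneStroke (iterBlockOf iterBlockOf_succ val_iterBlockOf)
open Summit.QuantumFields.YangMills.Theorems.Prop7TentInterpolation (val_embIter)
open Summit.QuantumFields.YangMills.Theorems.Prop7FlatHolonomy (sitesPerDir_zero_eq_mul_pow)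
open Literature.MathematicalPhysics.QuantumFieldTheory.BalabanImbrieJaffe1984to88.BIJ85ScalarPropagatorSupDecayDeriv (two_mul_pow_le_sitesPerDir)
open Summit.QuantumFields.YangMills.BalabanUVNodes.N12TowerForest (min_val_sub_eq_of_le)

variable {P : Params}

section Slab

/-- Blocks of two sites agreeing in a coordinate, off that coordinate equal after `blockOf`, stay so after the same update of that coordinate. [folklore] -/
theorem blockOf_update_congr {n : ℕ} {y y' : Site P n} {ν : Fin P.d} (hν : y ν = y' ν) (hoff : ∀ κ, κ ≠ ν → blockOf y κ = blockOf y' κ)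
    (g : ZMod (P.sitesPerDir n) → ZMod (P.sitesPerDir n)) :
    blockOf (Function.update y ν (g (y ν))) = blockOf (Function.update y' ν (g (y' ν))) := by
  funext κ
  by_cases hκ : κ = ν
  · subst hκ
    show (((Function.update y κ (g (y κ)) κ).val / P.L : ℕ) : ZMod (P.sitesPerDir (n + 1))) =
      (((Function.update y' κ (g (y' κ)) κ).val / P.L : ℕ) : ZMod (P.sitesPerDir (n + 1)))
    rw [Function.update_self, Function.update_self, hν]
  · have h := hoff κ hκ
    show (((Function.update y ν (g (y ν)) κ).val / P.L : ℕ) : ZMod (P.sitesPerDir (n + 1))) =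
      (((Function.update y' ν (g (y' ν)) κ).val / P.L : ℕ) : ZMod (P.sitesPerDir (n + 1)))
    rw [Function.update_of_ne hκ, Function.update_of_ne hκ]
    exact h

/-- The `ν`-summand of the torus distance, split off. [folklore] -/
theorem tdist_eq_add_sum_erase {j : ℕ} (w c : Site P j) (ν : Fin P.d) :
    Site.tdist w c = min (w ν - c ν).val (c ν - w ν).val + ∑ κ ∈ Finset.univ.erase ν, min (w κ - c κ).val (c κ - w κ).val := by
  unfold Site.tdist
  rw [← Finset.add_sum_erase _ _ (Finset.mem_univ ν)]

/-- ★★ **THE SLAB LEMMA**: inside one `(n+1)`-block, let `z` be one lattice step from `z′` and one unit FARTHER from the block's centre (torus distance), and let the `n`-block `y′` of `z′`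
have a lattice neighbour `y₀` (across direction `ν`) lying OUTSIDE the `(n+1)`-block; then the `n`-block of `z` has a neighbour `y₁` across the same direction and side, in the SAME
`(n+1)`-block as `y₀` (so outside too): `y′` lies in an extreme `ν`-slab of the block, a step off `ν` keeps the slab, a step along `ν` away from the centre keeps it, and a step along
`ν` toward the centre is excluded by the distance hypothesis (labels; `L ≥ 3` odd, period `2L^{m+K}`). [cite: Balaban1987RG1, (0.1)–(0.3) pp.251–252 (bookkeeping)] -/
theorem faceLayer_of_step {n : ℕ} (hn : n + 1 ≤ P.m + P.K) {z z' : Site P 0} {l : Letter P.d} (hstep : walkEnd z' [l] = z)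
    (hblk : iterBlockOf (n + 1) z' = iterBlockOf (n + 1) z)
    (hdist : Site.tdist z' (embIter (n + 1) (iterBlockOf (n + 1) z)) + 1 = Site.tdist z (embIter (n + 1) (iterBlockOf (n + 1) z)))
    {ν : Fin P.d} {y₀ : Site P n} (hadj : y₀ = (iterBlockOf n z').shift ν ∨ iterBlockOf n z' = y₀.shift ν)
    (hout : blockOf y₀ ≠ iterBlockOf (n + 1) z) :
    ∃ y₁ : Site P n, (y₁ = (iterBlockOf n z).shift ν ∨ iterBlockOf n z = y₁.shift ν) ∧ blockOf y₁ = blockOf y₀ := by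
  have hn0 : n ≤ P.m + P.K := by omega
  have hL3 : 3 ≤ P.L := by
    have h2 : 2 ≤ P.L := P.hL.2
    rcases P.hL.1 with ⟨t, ht⟩
    omega
  -- opaque sizes: `Ln = L^n`, `LJ = L^{n+1} = L·Ln`, the period `N0 = N·LJ` with `N ≥ 2`
  obtain ⟨Ln, hLn⟩ : ∃ Ln : ℕ, P.L ^ n = Ln := ⟨_, rfl⟩
  obtain ⟨LJ, hLJ⟩ : ∃ LJ : ℕ, P.L ^ (n + 1) = LJ := ⟨_, rfl⟩
  have hLnpos : 0 < Ln := hLn ▸ pow_pos P.L_pos n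
  have hLJ' : LJ = P.L * Ln := by rw [← hLJ, ← hLn, pow_succ, mul_comm]
  have hN0 : P.sitesPerDir 0 = P.sitesPerDir (n + 1) * LJ := hLJ ▸ sitesPerDir_zero_eq_mul_pow hn
  have hN2 : 2 ≤ P.sitesPerDir (n + 1) := by
    have h := two_mul_pow_le_sitesPerDir (P := P) hn
    rw [hLJ, hN0] at h
    have hLJpos : 0 < LJ := hLJ ▸ pow_pos P.L_pos (n + 1)
    exact le_of_mul_le_mul_right h hLJpos
  have hNn : P.sitesPerDir n = P.sitesPerDir (n + 1) * P.L := P.sitesPerDir_eq_mul_succ hn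
  -- off `ν` the blocks of `B^n z`, `B^n z′` agree after `blockOf` (same `(n+1)`-block)
  have hblk' : blockOf (iterBlockOf n z) = blockOf (iterBlockOf n z') := by
    rw [← iterBlockOf_succ, ← iterBlockOf_succ]; exact hblk.symm
  have hoff : ∀ κ, κ ≠ ν → blockOf (iterBlockOf n z) κ = blockOf (iterBlockOf n z') κ := fun κ _ => congrFun hblk' κ
  -- THE KEY: the `ν`-index of the `n`-block does not change from `z′` to `z`
  suffices hkey : iterBlockOf n z ν = iterBlockOf n z' ν by
    rcases hadj with rfl | hy'
    · exact ⟨(iterBlockOf n z).shift ν, Or.inl rfl, blockOf_update_congr hkey hoff (· + 1)⟩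
    · refine ⟨(iterBlockOf n z).unshift ν, Or.inr (Site.shift_unshift _ ν).symm, ?_⟩
      have hy₀ : y₀ = (iterBlockOf n z').unshift ν := by rw [hy', Site.unshift_shift]
      rw [hy₀]
      exact blockOf_update_congr hkey hoff (· - 1)
  -- the step: `z = z′ ± e_μ`
  obtain ⟨μ, b⟩ := l
  by_cases hμν : μ ≠ ν
  · -- a step off `ν` does not move the `ν`-label
    have hzν : z ν = z' ν := by
      rw [← hstep]; cases b <;> simp [walkEnd, Site.shift, Site.unshift, Function.update_of_ne (Ne.symm hμν)]
    apply ZMod.val_injective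
    rw [val_iterBlockOf n hn0, val_iterBlockOf n hn0, hzν]
  rw [not_not] at hμν
  subst hμν
  -- labels in coordinate `μ`
  obtain ⟨a, ha⟩ : ∃ a : ℕ, (z μ).val = a := ⟨_, rfl⟩
  obtain ⟨a', ha'⟩ : ∃ a' : ℕ, (z' μ).val = a' := ⟨_, rfl⟩
  have halt : a < P.sitesPerDir 0 := ha ▸ ZMod.val_lt _
  have ha'lt : a' < P.sitesPerDir 0 := ha' ▸ ZMod.val_lt _
  -- the common `(n+1)`-block index `Bμ` and the centre label `A + H`
  obtain ⟨Bμ, hBμ⟩ : ∃ q : ℕ, (iterBlockOf (n + 1) z μ).val = q := ⟨_, rfl⟩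
  have hqa : a / LJ = Bμ := by rw [← hBμ, val_iterBlockOf (n + 1) hn, ha, hLJ]
  have hqa' : a' / LJ = Bμ := by rw [← hBμ, ← hblk, val_iterBlockOf (n + 1) hn, ha', hLJ]
  obtain ⟨H, hH⟩ : ∃ H : ℕ, (LJ - 1) / 2 = H := ⟨_, rfl⟩
  have hodd : LJ % 2 = 1 := hLJ ▸ Nat.odd_iff.mp (Odd.pow P.hL.1)
  have hH2 : 2 * H + 1 = LJ := by omega
  have hcval : (embIter (n + 1) (iterBlockOf (n + 1) z) μ).val = LJ * Bμ + H := by rw [val_embIter hn, hBμ, hLJ, hH, mul_comm]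
  -- `a, a′ ∈ [Bμ·LJ, Bμ·LJ + LJ)`
  obtain ⟨ra, hra⟩ : ∃ r : ℕ, a % LJ = r := ⟨_, rfl⟩
  obtain ⟨ra', hra'⟩ : ∃ r : ℕ, a' % LJ = r := ⟨_, rfl⟩
  have hLJpos : 0 < LJ := hLJ ▸ pow_pos P.L_pos (n + 1)
  have hda : LJ * Bμ + ra = a := by rw [← hqa, ← hra]; exact Nat.div_add_mod a LJ
  have hda' : LJ * Bμ + ra' = a' := by rw [← hqa', ← hra']; exact Nat.div_add_mod a' LJ
  have hralt : ra < LJ := hra ▸ Nat.mod_lt a hLJpos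
  have hra'lt : ra' < LJ := hra' ▸ Nat.mod_lt a' hLJpos
  -- the relation between `a` and `a′`: `a = a′ + 1` (forward step) or `a′ = a + 1` (backward step), no wrap inside one block
  have hsucc : ∀ {w w' : Site P 0} {e e' : ℕ}, (w μ).val = e → (w' μ).val = e' → w' μ = w μ + 1 → e / LJ = Bμ → e' / LJ = Bμ → e' = e + 1 := by
    intro w w' e e' he he' hw hq hq'
    have helt : e < P.sitesPerDir 0 := he ▸ ZMod.val_lt _
    have h1 : e' = (e + 1) % P.sitesPerDir 0 := by
      have := congrArg ZMod.val hw
      rw [ZMod.val_add, ZMod.val_one_eq_one_mod, Nat.add_mod_mod, he, he'] at this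
      exact this
    have h2 : e + 1 ≤ P.sitesPerDir 0 := helt
    rcases h2.lt_or_eq with hlt | heq
    · rw [h1, Nat.mod_eq_of_lt hlt]
    · exfalso
      rw [h1, heq, Nat.mod_self, Nat.zero_div] at hq'
      rw [← hq', Nat.div_eq_zero_iff_lt hLJpos] at hq
      have h3 : 2 * LJ ≤ P.sitesPerDir 0 := by rw [hN0]; exact Nat.mul_le_mul_right _ hN2
      omega
  -- the `μ`-summand of the torus distance inside the block: `|e − (Bμ·LJ + H)|`
  have hD : ∀ {w : Site P 0} {e : ℕ}, (w μ).val = e → e / LJ = Bμ →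
      (min (w μ - embIter (n + 1) (iterBlockOf (n + 1) z) μ).val (embIter (n + 1) (iterBlockOf (n + 1) z) μ - w μ).val = e - (LJ * Bμ + H) ∧ LJ * Bμ + H ≤ e) ∨
      (min (w μ - embIter (n + 1) (iterBlockOf (n + 1) z) μ).val (embIter (n + 1) (iterBlockOf (n + 1) z) μ - w μ).val = (LJ * Bμ + H) - e ∧ e ≤ LJ * Bμ + H) := by
    intro w e he hq
    have hN := two_mul_pow_le_sitesPerDir (P := P) hn
    rw [hLJ] at hN
    obtain ⟨re, hre⟩ : ∃ r : ℕ, e % LJ = r := ⟨_, rfl⟩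
    have hde : LJ * Bμ + re = e := by rw [← hq, ← hre]; exact Nat.div_add_mod e LJ
    have hme : re < LJ := hre ▸ Nat.mod_lt e hLJpos
    rcases le_total (LJ * Bμ + H) e with hle | hle
    · left
      refine ⟨?_, hle⟩
      rw [← he, ← hcval] at hle ⊢
      exact min_val_sub_eq_of_le hle (by rw [he, hcval]; omega)
    · right
      refine ⟨?_, hle⟩
      rw [← he, ← hcval] at hle ⊢
      rw [min_comm]
      exact min_val_sub_eq_of_le hle (by rw [he, hcval]; omega)
  -- the distance hypothesis read in coordinate `μ`
  have hrest : ∑ κ ∈ Finset.univ.erase μ, min (z' κ - embIter (n + 1) (iterBlockOf (n + 1) z) κ).val (embIter (n + 1) (iterBlockOf (n + 1) z) κ - z' κ).val =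
      ∑ κ ∈ Finset.univ.erase μ, min (z κ - embIter (n + 1) (iterBlockOf (n + 1) z) κ).val (embIter (n + 1) (iterBlockOf (n + 1) z) κ - z κ).val := by
    refine Finset.sum_congr rfl fun κ hκ => ?_
    rw [Finset.mem_erase] at hκ
    have : z' κ = z κ := by
      rw [← hstep]; cases b <;> simp [walkEnd, Site.shift, Site.unshift, Function.update_of_ne hκ.1]
    rw [this]
  have hdμ : min (z' μ - embIter (n + 1) (iterBlockOf (n + 1) z) μ).val (embIter (n + 1) (iterBlockOf (n + 1) z) μ - z' μ).val + 1 =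
      min (z μ - embIter (n + 1) (iterBlockOf (n + 1) z) μ).val (embIter (n + 1) (iterBlockOf (n + 1) z) μ - z μ).val := by
    have h := hdist
    rw [tdist_eq_add_sum_erase z' _ μ, tdist_eq_add_sum_erase z _ μ, hrest] at h
    omega
  -- the face hypothesis in labels: `q′ := a′ / Ln` is `≡ L − 1 (mod L)` (+ side) or `≡ 0 (mod L)` (− side)
  obtain ⟨q', hq'⟩ : ∃ q : ℕ, (iterBlockOf n z' μ).val = q := ⟨_, rfl⟩
  have hq'a : a' / Ln = q' := by rw [← hq', val_iterBlockOf n hn0, ha', hLn]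
  have hq'lt : q' < P.sitesPerDir n := hq' ▸ ZMod.val_lt _
  have hq'L : q' / P.L = Bμ := by rw [← hq'a, Nat.div_div_eq_div_mul, ← hLJ'.trans (mul_comm _ _), hqa']
  obtain ⟨q, hq⟩ : ∃ q : ℕ, (iterBlockOf n z μ).val = q := ⟨_, rfl⟩
  have hqaL : a / Ln = q := by rw [← hq, val_iterBlockOf n hn0, ha, hLn]
  -- goal in labels
  suffices hqq : q = q' by
    apply ZMod.val_injective; rw [hq, hq', hqq]
  have hdq' := Nat.div_add_mod a' Ln
  have hdq := Nat.div_add_mod a Ln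
  obtain ⟨sa, hsa⟩ : ∃ s : ℕ, a % Ln = s := ⟨_, rfl⟩
  obtain ⟨sa', hsa'⟩ : ∃ s : ℕ, a' % Ln = s := ⟨_, rfl⟩
  have hsalt : sa < Ln := hsa ▸ Nat.mod_lt a hLnpos
  have hsa'lt : sa' < Ln := hsa' ▸ Nat.mod_lt a' hLnpos
  rw [hqaL, hsa] at hdq
  rw [hq'a, hsa'] at hdq'
  -- `q′ = Bμ·L + t′` with `t′ = q′ % L`; the face hypothesis pins `t′`
  obtain ⟨t', ht'⟩ : ∃ t : ℕ, q' % P.L = t := ⟨_, rfl⟩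
  have hdt' : P.L * Bμ + t' = q' := by rw [← hq'L, ← ht']; exact Nat.div_add_mod q' P.L
  have ht'lt : t' < P.L := ht' ▸ Nat.mod_lt q' P.L_pos
  -- products as atoms
  obtain ⟨M, hM⟩ : ∃ M : ℕ, (P.L - 1) * Ln = M := ⟨_, rfl⟩
  have hMLJ : M + Ln = LJ := by
    rw [← hM, hLJ']
    rcases Nat.exists_eq_add_of_le (show 1 ≤ P.L from P.L_pos) with ⟨t, ht⟩
    rw [ht, Nat.add_sub_cancel_left]; ring
  have hM2 : 2 * Ln ≤ M := by rw [← hM]; exact Nat.mul_le_mul_right _ (by omega)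
  have hBL : LJ * Bμ = Ln * (P.L * Bμ) := by rw [hLJ']; ring
  obtain ⟨T, hT⟩ : ∃ T : ℕ, Ln * t' = T := ⟨_, rfl⟩
  have ha'T : a' = LJ * Bμ + T + sa' := by
    rw [← hdq', ← hdt', ← hT, hBL]; ring
  -- the face side
  rcases hadj with hy₀ | hy'
  · -- (+ side) `y₀ = y′ + e_μ` lies outside the block ⇒ `t′ = L − 1`, i.e. `T = M`
    have ht'eq : t' = P.L - 1 := by
      by_contra hne
      have ht'lt' : t' + 1 < P.L := by omega
      apply hout
      rw [hy₀, ← hblk, iterBlockOf_succ]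
      funext κ
      by_cases hκ : κ = μ
      · subst hκ
        show ((((iterBlockOf n z').shift κ κ).val / P.L : ℕ) : ZMod (P.sitesPerDir (n + 1))) = ((((iterBlockOf n z') κ).val / P.L : ℕ) : ZMod _)
        have hv : ((iterBlockOf n z').shift κ κ).val = q' + 1 := by
          simp only [Site.shift, Function.update_self]
          rw [ZMod.val_add, ZMod.val_one_eq_one_mod, Nat.add_mod_mod, hq']
          apply Nat.mod_eq_of_lt
          rw [hNn]
          have : P.L * Bμ + t' + 1 < P.L * (Bμ + 1) := by rw [mul_add, mul_one]; omega
          have hBlt : Bμ < P.sitesPerDir (n + 1) := hBμ ▸ ZMod.val_lt _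
          calc q' + 1 = P.L * Bμ + t' + 1 := by rw [hdt']
            _ < P.L * (Bμ + 1) := this
            _ ≤ P.L * P.sitesPerDir (n + 1) := Nat.mul_le_mul_left _ hBlt
            _ = P.sitesPerDir (n + 1) * P.L := mul_comm _ _
        rw [hv, hq']
        congr 1
        rw [← hdt', add_assoc, Nat.mul_add_div P.L_pos, Nat.mul_add_div P.L_pos,
          Nat.div_eq_of_lt ht'lt, Nat.div_eq_of_lt ht'lt']
      · show ((((iterBlockOf n z').shift μ κ).val / P.L : ℕ) : ZMod (P.sitesPerDir (n + 1))) = ((((iterBlockOf n z') κ).val / P.L : ℕ) : ZMod _)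
        simp only [Site.shift, Function.update_of_ne hκ]
    have hTM : T = M := by rw [← hT, ← hM, ht'eq, mul_comm]
    rw [hTM] at ha'T
    -- so `a′ ≥ LJ·Bμ + M`; the step
    cases b
    · -- backward step `z = z′ − e_μ`, i.e. `z′ = z + e_μ`: `a′ = a + 1`, but `z` is farther from the centre — excluded
      exfalso
      have hz' : z' μ = z μ + 1 := by
        have : z' = z.shift μ := by rw [← hstep]; simp [walkEnd]
        rw [this]; simp [Site.shift]
      have haa : a' = a + 1 := hsucc ha ha' hz' hqa hqa'
      rcases hD ha hqa with ⟨h1, h1'⟩ | ⟨h1, h1'⟩ <;> rcases hD ha' hqa' with ⟨h2, h2'⟩ | ⟨h2, h2'⟩ <;> omega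
    · -- forward step `z = z′ + e_μ`: `a = a′ + 1` stays in the slab
      have hz : z μ = z' μ + 1 := by
        have : z = z'.shift μ := by rw [← hstep]; simp [walkEnd]
        rw [this]; simp [Site.shift]
      have haa : a = a' + 1 := hsucc ha' ha hz hqa' hqa
      -- `q = a / Ln = L·Bμ + (L−1) = q′`
      have hLnM : Ln * (P.L - 1) = M := by rw [← hM, mul_comm]
      have hlo : Ln * (P.L * Bμ + (P.L - 1)) ≤ a := by
        have : Ln * (P.L * Bμ + (P.L - 1)) = LJ * Bμ + M := by rw [mul_add, ← hBL, hLnM]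
        omega
      have hhi : a < Ln * (P.L * Bμ + (P.L - 1) + 1) := by
        have : Ln * (P.L * Bμ + (P.L - 1) + 1) = LJ * Bμ + M + Ln := by rw [mul_add, mul_add, ← hBL, hLnM, mul_one]
        omega
      have hqv : q = P.L * Bμ + (P.L - 1) := by
        rw [← hqaL]; exact Nat.div_eq_of_lt_le (by rw [mul_comm]; exact hlo) (by rw [mul_comm]; exact hhi)
      rw [hqv, ← hdt', ht'eq]
  · -- (− side) `y′ = y₀ + e_μ`, `y₀` outside the block ⇒ `t′ = 0`, i.e. `T = 0`
    have ht'eq : t' = 0 := by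
      by_contra hne
      apply hout
      rw [← hblk, iterBlockOf_succ, hy']
      funext κ
      by_cases hκ : κ = μ
      · subst hκ
        show ((((y₀ κ).val / P.L : ℕ)) : ZMod (P.sitesPerDir (n + 1))) = ((((y₀.shift κ κ).val / P.L : ℕ)) : ZMod _)
        -- `y₀ κ + 1 = y′ κ` has label `q′ ≥ 1` with `q′ % L = t′ ≠ 0`: no wrap, same quotient
        have hv1 : ((y₀.shift κ) κ).val = q' := by rw [← hy']; exact hq'
        obtain ⟨q₀, hq₀⟩ : ∃ q₀ : ℕ, (y₀ κ).val = q₀ := ⟨_, rfl⟩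
        have hq₀lt : q₀ < P.sitesPerDir n := hq₀ ▸ ZMod.val_lt _
        have hrel : q' = (q₀ + 1) % P.sitesPerDir n := by
          rw [← hv1]; simp only [Site.shift, Function.update_self]
          rw [ZMod.val_add, ZMod.val_one_eq_one_mod, Nat.add_mod_mod, hq₀]
        have hq01 : q₀ + 1 = q' := by
          have h2 : q₀ + 1 ≤ P.sitesPerDir n := hq₀lt
          rcases h2.lt_or_eq with hlt | heq
          · rw [hrel, Nat.mod_eq_of_lt hlt]
          · exfalso
            rw [heq, Nat.mod_self] at hrel
            rw [hrel] at hdt'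
            have : t' = 0 := by omega
            exact hne this
        rw [hv1, hq₀]
        congr 1
        rw [← hdt'] at hq01 ⊢
        have hq₀v : q₀ = P.L * Bμ + (t' - 1) := by omega
        rw [hq₀v, Nat.mul_add_div P.L_pos, Nat.mul_add_div P.L_pos, Nat.div_eq_of_lt ht'lt,
          Nat.div_eq_of_lt (by omega : t' - 1 < P.L)]
      · show ((((y₀ κ).val / P.L : ℕ)) : ZMod (P.sitesPerDir (n + 1))) = ((((y₀.shift μ κ).val / P.L : ℕ)) : ZMod _)
        simp only [Site.shift, Function.update_of_ne hκ]
    have hT0 : T = 0 := by rw [← hT, ht'eq, mul_zero]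
    rw [hT0, add_zero] at ha'T
    cases b
    · -- backward step `z′ = z + e_μ`: `a′ = a + 1`, both in the first slab
      have hz' : z' μ = z μ + 1 := by
        have : z' = z.shift μ := by rw [← hstep]; simp [walkEnd]
        rw [this]; simp [Site.shift]
      have haa : a' = a + 1 := hsucc ha ha' hz' hqa hqa'
      have hlo : Ln * (P.L * Bμ) ≤ a := by
        have : Ln * (P.L * Bμ) = LJ * Bμ := by rw [← hBL]
        omega
      have hhi : a < Ln * (P.L * Bμ + 1) := by
        have : Ln * (P.L * Bμ + 1) = LJ * Bμ + Ln := by rw [mul_add, ← hBL, mul_one]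
        omega
      have hqv : q = P.L * Bμ := by
        rw [← hqaL]; exact Nat.div_eq_of_lt_le (by rw [mul_comm]; exact hlo) (by rw [mul_comm]; exact hhi)
      rw [hqv, ← hdt', ht'eq, add_zero]
    · -- forward step `z = z′ + e_μ`: `a = a′ + 1` toward the centre — excluded by the distance hypothesis
      exfalso
      have hz : z μ = z' μ + 1 := by
        have : z = z'.shift μ := by rw [← hstep]; simp [walkEnd]
        rw [this]; simp [Site.shift]
      have haa : a = a' + 1 := hsucc ha' ha hz hqa' hqa
      rcases hD ha hqa with ⟨h1, h1'⟩ | ⟨h1, h1'⟩ <;> rcases hD ha' hqa' with ⟨h2, h2'⟩ | ⟨h2, h2'⟩ <;> omega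

end Slab

end Summit.QuantumFields.YangMills.BalabanUVNodes.N12TowerForestSlab

end
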